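import Literature.NumberTheory.LFunctions.RodgersTaoLogDerivPoissonProofs
import Literature.NumberTheory.LFunctions.RodgersTaoLogDerivPropagationProofs
import Literature.NumberTheory.LFunctions.RodgersTaoLocationUniformProofs
import HarnessLib

/-!
# Rodgers–Tao 2020, Theorem 9 (49) `N_t([T, T+α log₊T]) = α log²₊T/(4π) + o(log²₊T)` WITH CONTENT

Trunk T-ANT (`Literature/NumberTheory/LFunctions`). PROOFS ONLY: no definition, no named fact.
LINE 1 — LABEL: RH-FREE literature (Rodgers–Tao 2020, §3); bears_on LADDER-RH N-C/N-P
(COLUMN 3, DBN). WHAT THIS IS NOT: a statement about `H_t` at times above a real-rooted time —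
vacuous for `ζ` at `t < 0` (the tree proves `Λ ≥ 0`), RH's business at `t = 0`; proving the printed
chain WITH CONTENT certifies the source's derivation, it does not move RH. Nothing in this file
bears on the truth of RH.

## What is proved

B. Rodgers, T. Tao, *The de Bruijn–Newman constant is non-negative*, Forum Math. Pi 8 (2020) e6,
Theorem 9 (= arXiv v4 Theorem 3.2), eq. (49), p. 23: «`N_t([T, T + α log₊ T]) = α log²₊T/(4π) +
o_{T→∞}(log²₊ T)` … the decay rate … uniform in `α`» for `Λ < t ≤ 0`, `0 ≤ α ≤ C`.

* `RodgersTao2020.thm32_littleO_inner (T₀)` — RH-FREE, over the kernel theorems, uniformly on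
  `[−T₀, 0]`: `∀ C>0 ∀ ε>0 ∃ T₂ ∀ t ∈ [−T₀, 0]` above a real-rooted time `∀ α ∈ [0, C] ∀ T ≥ T₂`,
  `|N_t([T, T + α log₊T]) − α log²₊T/(4π)| ≤ ε log²₊T`.
* `RodgersTao2020.thm32_littleO_content : thm32_littleO` — (49) AS PRINTED, WITH CONTENT (Newman's
  lower bound for the real-rooted times + the inner theorem; no use of `Λ ≥ 0`; so far the tree
  had only the EX-FALSO `thm32_littleO_holds`).

## The route (effective; replaces the printed normal-families + argument-principle proof, p. 25)

(A) Poisson representation `Im H_t′/H_t(u − iY) = Σ_j [P_Y(u − x_j) + P_Y(u + x_j)]` over the real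
simple zeros (Hadamard product), local densities and the arctan counting profile
(`RodgersTaoLogDerivPoissonProofs.lean`); (B) propagation of Lemma 2.1 (9) from depth `κ log₊T`
to depth `δ log₊T` with a rate `L^{−θ}` by Borel–Carathéodory off-centre + Hadamard three circles
(`RodgersTaoLogDerivPropagationProofs.lean`, the quantitative form of «F_n′ → 1/4 locally
uniformly»); (C) counting in `[T, T + αL]` from above/below with boundary layers `η₀L` and the
out-of-window tail through the Poisson sums at height `η₀L` (`count_window_upper/lower`); (D) here:
`K = C + 2`, `η₀ = min(1, ε)`, `ρ = min(1, ε/(C+1))`, `δ = η₀ρ/2`, `E = Cst L^{−θ} ≤ min(1/4,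
ε/(2(C+2)))` for `T ≥ T₂`, and the two inequality chains giving `±ε log²₊T`. The heartbeat budget
of the final assembly is raised locally (one `set_option maxHeartbeats` on `thm32_littleO_inner`;
pure linear-arithmetic bookkeeping in a large context).

## References

* B. Rodgers, T. Tao, *The de Bruijn–Newman constant is non-negative*, Forum Math. Pi 8 (2020),
  e6 = arXiv:1801.05914: Theorem 9 (49) p. 23 and its proof p. 25; Lemma 4 (7)–(9) p. 8.
  [RodgersTaoFMP2020]
* C. M. Newman, *Fourier transforms with only real zeros*, Proc. AMS 61 (1976), Thm. 3 (`Λ > −∞`).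
  [Newman1976]
-/

noncomputable section

open Complex Set Filter Topology
open scoped Real

namespace Literature.NumberTheory.LFunctions

namespace RodgersTao2020

open RodgersTaoLogDerivPoisson RodgersTaoLogDerivPropagation

/-- `π/2 − arctan u ≤ 1/u` for `u > 0`, in the form `π − 2/u ≤ 2 arctan u`. [folklore] -/
private theorem pi_sub_le_two_mul_arctan {u : ℝ} (hu : 0 < u) : π - 2 / u ≤ 2 * Real.arctan u := by
  have h1 : Real.arctan u⁻¹ = π / 2 - Real.arctan u := Real.arctan_inv_of_pos hu
  have h2 : Real.arctan u⁻¹ ≤ u⁻¹ := by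
    have hD : Convex ℝ (Ici (0 : ℝ)) := convex_Ici 0
    have h := hD.image_sub_le_mul_sub_of_deriv_le Real.continuous_arctan.continuousOn
      Real.differentiable_arctan.differentiableOn (C := 1) (fun x _ ↦ by
        rw [Real.deriv_arctan]
        rw [div_le_one (by positivity)]; nlinarith) 0 (mem_Ici.2 le_rfl) u⁻¹
      (mem_Ici.2 (inv_pos.2 hu).le) (inv_pos.2 hu).le
    simpa using h
  have h3 : u⁻¹ = 1 / u := inv_eq_one_div u
  rw [h3] at h2 h1
  have : 2 / u = 2 * (1 / u) := by ring
  linarith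

/-- The point identity `u − i yL = T + (s − iy)L` for `u = T + sL`. [folklore] -/
private theorem point_eq (T s y L : ℝ) :
    (((T + s * L : ℝ) : ℂ) - ((y * L : ℝ) : ℂ) * I) =
      (T : ℂ) + ((s : ℂ) - (y : ℂ) * I) * (L : ℂ) := by
  push_cast; ring

set_option maxHeartbeats 1600000 in
/-- **Theorem 3.2 (49) — RH-FREE, over the kernel theorems, uniformly on `[−T₀, 0]` (the
EFFECTIVE route).** For every `T₀`, `C > 0`, `ε > 0` there is `T₂` such that for all
`t ∈ [−T₀, 0]` above a real-rooted time, all `0 ≤ α ≤ C` and all `T ≥ T₂`: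
`|N_t([T, T + α log₊ T]) − α log₊² T/(4π)| ≤ ε log₊² T`. Assembly of: stage B
(`RodgersTaoLogDerivPropagation.exists_im_logDeriv_bounds`: `Im H_t′/H_t = (1/4 + O(L^{−θ}))L` at
heights `yL`, `δ ≤ y ≤ K`, by Borel–Carathéodory + three circles from Lemma 2.1 (7)(8)(9)) and
stage C (`RodgersTaoLogDerivPoisson.count_window_upper/lower`: Poisson/arctan counting at height
`δL` with boundary layers `η₀L` and the out-of-window tail through the Poisson sums at height
`η₀L`), with `K = C + 2`, `η₀ = min(1, ε)`, `ρ = min(1, ε/(C+1))`, `δ = η₀ρ/2`, and `T₂` so large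
that `Cst·L^{−θ} ≤ min(1/4, ε/(2(C+2)))`. This replaces the normal-families/argument-principle
proof printed on p. 25 by an effective argument with the same conclusion.
[cite: RodgersTaoFMP2020, Theorem 3.2 (49) = Theorem 9 (49) p.23, proof p.25] -/
theorem thm32_littleO_inner (T₀ : ℝ) :
    ∀ C : ℝ, 0 < C → ∀ ε : ℝ, 0 < ε → ∃ T₂ : ℝ,
      ∀ t ∈ Icc (-T₀) 0, (∃ t₁ : ℝ, t₁ < t ∧ HasOnlyRealZeros (deBruijnH t₁)) →
        ∀ α : ℝ, 0 ≤ α → α ≤ C → ∀ T : ℝ, T₂ ≤ T →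
          |(deBruijnZeroCount t (Icc T (T + α * logPlus T)) : ℝ) - α * logPlus T ^ 2 / (4 * π)| ≤
            ε * logPlus T ^ 2 := by
  intro C hC ε hε
  have hπ : 0 < π := Real.pi_pos
  have hπ3 : 3 < π := Real.pi_gt_three
  -- parameters
  set K : ℝ := C + 2 with hK
  set η₀ : ℝ := min 1 ε with hη₀
  set ρ : ℝ := min 1 (ε / (C + 1)) with hρ
  set δ : ℝ := η₀ * ρ / 2 with hδ
  have hK1 : 1 ≤ K := by rw [hK]; linarith
  have hη₀0 : 0 < η₀ := lt_min one_pos hε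
  have hη₀1 : η₀ ≤ 1 := min_le_left _ _
  have hη₀ε : η₀ ≤ ε := min_le_right _ _
  have hρ0 : 0 < ρ := lt_min one_pos (by positivity)
  have hρ1 : ρ ≤ 1 := min_le_left _ _
  have hρε : ρ ≤ ε / (C + 1) := min_le_right _ _
  have hρε' : ρ * (C + 1) ≤ ε := by rwa [le_div_iff₀ (by linarith)] at hρε
  have hδ0 : 0 < δ := by rw [hδ]; positivity
  have hδη : δ ≤ η₀ := by rw [hδ]; nlinarith
  have hδ1 : δ ≤ 1 := hδη.trans hη₀1
  have hδK : η₀ ≤ K := by linarith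
  have hρδ : 2 * δ / η₀ = ρ := by rw [hδ]; field_simp
  -- stage B
  obtain ⟨T₁, Cst, θ, hθ, hCst, hB⟩ := exists_im_logDeriv_bounds T₀ hδ0 hδ1 hK1
  set E₀ : ℝ := min (1 / 4) (ε / (2 * (C + 2))) with hE₀
  have hE₀0 : 0 < E₀ := lt_min (by norm_num) (by positivity)
  have hE₀4 : E₀ ≤ 1 / 4 := min_le_left _ _
  have hE₀ε : E₀ ≤ ε / (2 * (C + 2)) := min_le_right _ _
  have hE₀ε' : E₀ * (2 * (C + 2)) ≤ ε := by rwa [le_div_iff₀ (by positivity)] at hE₀ε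
  set M : ℝ := Cst / E₀ + 1 with hM
  have hM0 : 0 < M := by rw [hM]; positivity
  set T₃ : ℝ := Real.exp (M ^ (1 / θ)) with hT₃
  refine ⟨max T₁ (max 1 T₃), fun t ht hΛ α hα0 hαC T hT ↦ ?_⟩
  have hT1 : T₁ ≤ T := (le_max_left _ _).trans hT
  have hTone : 1 ≤ T := (le_max_left _ _).trans ((le_max_right _ _).trans hT)
  have hT3 : T₃ ≤ T := (le_max_right _ _).trans ((le_max_right _ _).trans hT)
  have hreal : HasOnlyRealZeros (deBruijnH t) := hasOnlyRealZeros_of_exists_lt hΛ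
  set L : ℝ := Real.log (2 + T) with hL
  have hL0 : 0 < L := Real.log_pos (by linarith)
  have hLP : logPlus T = L := by rw [logPlus_of_nonneg (by linarith)]
  rw [hLP]
  -- the error `E = Cst L^{−θ} ≤ E₀`
  set E : ℝ := Cst * L ^ (-θ) with hEdef
  have hE0 : 0 ≤ E := by rw [hEdef]; exact mul_nonneg hCst (Real.rpow_nonneg hL0.le _)
  have hE : E ≤ E₀ := by
    have hLM : M ≤ L ^ θ := by
      have h1 : M ^ (1 / θ) ≤ L := by
        have : Real.log (Real.exp (M ^ (1 / θ))) ≤ Real.log (2 + T) :=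
          Real.log_le_log (Real.exp_pos _) (by linarith)
        rwa [Real.log_exp] at this
      have h2 := Real.rpow_le_rpow (Real.rpow_nonneg hM0.le _) h1 hθ.le
      rwa [← Real.rpow_mul hM0.le, one_div_mul_cancel hθ.ne', Real.rpow_one] at h2
    have hLθ : 0 < L ^ θ := Real.rpow_pos_of_pos hL0 _
    rw [hEdef, Real.rpow_neg hL0.le, ← div_eq_mul_inv, div_le_iff₀ hLθ]
    have h3 : Cst ≤ E₀ * M := by
      rw [hM, mul_add, mul_div_cancel₀ _ hE₀0.ne', mul_one]; linarith
    nlinarith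
  have hE4 : E ≤ 1 / 4 := hE.trans hE₀4
  have hEC : E * (2 * (C + 2)) ≤ ε := le_trans (mul_le_mul_of_nonneg_right hE (by positivity)) hE₀ε'
  -- Poisson control at heights `δL` and `η₀L` from stage B
  have hpt : ∀ s y : ℝ, |s| ≤ K → y ∈ Icc δ K →
      (1 / 4 - E) * L ≤ (logDeriv (deBruijnH t) (((T + s * L : ℝ) : ℂ) - ((y * L : ℝ) : ℂ) * I)).im ∧
        (logDeriv (deBruijnH t) (((T + s * L : ℝ) : ℂ) - ((y * L : ℝ) : ℂ) * I)).im ≤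
          (1 / 4 + E) * L := by
    intro s y hs hy
    have h := hB t ht hreal T hT1 s hs y hy
    rw [point_eq, logDeriv_apply]
    exact h
  have hsK : ∀ s : ℝ, -η₀ ≤ s → s ≤ α + η₀ → |s| ≤ K := fun s h1 h2 ↦ by
    rw [abs_le]; constructor <;> linarith
  have hδI : δ ∈ Icc δ K := ⟨le_rfl, hδη.trans hδK⟩
  have hη₀I : η₀ ∈ Icc δ K := ⟨hδη, hδK⟩
  -- rewrite points `u` of an interval as `T + sL`
  have hus : ∀ u : ℝ, u = T + (u - T) / L * L := fun u ↦ by field_simp; ring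
  have hU : ∀ u ∈ Icc (T - η₀ * L) (T + α * L + η₀ * L),
      (logDeriv (deBruijnH t) ((u : ℂ) - ((δ * L : ℝ) : ℂ) * I)).im ≤ (1 / 4 + E) * L := by
    intro u hu
    have h1 : -η₀ ≤ (u - T) / L := by rw [le_div_iff₀ hL0]; linarith [hu.1]
    have h2 : (u - T) / L ≤ α + η₀ := by rw [div_le_iff₀ hL0]; linarith [hu.2]
    have h := (hpt ((u - T) / L) δ (hsK ((u - T) / L) h1 h2) hδI).2
    rwa [← hus u] at h
  set N : ℝ := (deBruijnZeroCount t (Icc T (T + α * L)) : ℝ) with hN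
  have hN0 : 0 ≤ N := by rw [hN]; exact Nat.cast_nonneg _
  -- UPPER
  have hup := count_window_upper hΛ (E := E) (T := T) hL0 hδ0 hη₀0 hα0 hU
  have harc : π - ρ ≤ 2 * Real.arctan (η₀ / δ) := by
    have h := pi_sub_le_two_mul_arctan (div_pos hη₀0 hδ0)
    have e : 2 / (η₀ / δ) = ρ := by rw [← hρδ]; field_simp
    rwa [e] at h
  have hL2 : 0 ≤ L ^ 2 := sq_nonneg L
  have hεL : 0 ≤ ε * L ^ 2 := by positivity
  have hρε2 : ρ ≤ ε := hρε.trans (div_le_self hε.le (by linarith))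
  have hαη : α + 2 * η₀ ≤ C + 2 := by linarith
  have hupper : N - α * L ^ 2 / (4 * π) ≤ ε * L ^ 2 := by
    set P : ℝ := (1 / 4 + E) * (α + 2 * η₀) with hP
    have h1 : N * (π - ρ) ≤ P * L ^ 2 := le_trans (mul_le_mul_of_nonneg_left harc hN0) hup
    have hP0 : 0 ≤ P := by positivity
    have hPle : P ≤ 1 / 2 * (C + 2) :=
      mul_le_mul (by linarith) hαη (by positivity) (by norm_num)
    -- crude bound `N ≤ (C+2) L²/4`
    have h2 : N ≤ (C + 2) * L ^ 2 / 4 := by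
      have hpr : 2 ≤ π - ρ := by linarith
      have a1 : N * 2 ≤ N * (π - ρ) := mul_le_mul_of_nonneg_left hpr hN0
      have a2 : P * L ^ 2 ≤ 1 / 2 * (C + 2) * L ^ 2 := mul_le_mul_of_nonneg_right hPle hL2
      linarith
    have h4 : ρ * N ≤ ε * L ^ 2 / 2 := by
      have a1 : ρ * N ≤ ρ * ((C + 2) * L ^ 2 / 4) := mul_le_mul_of_nonneg_left h2 hρ0.le
      have a2 : ρ * (C + 2) ≤ 2 * ε := by
        have e : ρ * (C + 2) = ρ * (C + 1) + ρ := by ring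
        linarith
      have a3 : ρ * ((C + 2) * L ^ 2 / 4) = ρ * (C + 2) / 4 * L ^ 2 := by ring
      have a4 : ρ * (C + 2) / 4 * L ^ 2 ≤ 2 * ε / 4 * L ^ 2 :=
        mul_le_mul_of_nonneg_right (by linarith) hL2
      linarith
    have h6 : π * N ≤ P * L ^ 2 + ρ * N := by
      have e : N * (π - ρ) = π * N - ρ * N := by ring
      linarith
    have h7 : P ≤ α / 4 + η₀ / 2 + E * (C + 2) := by
      have a1 : E * (α + 2 * η₀) ≤ E * (C + 2) := mul_le_mul_of_nonneg_left hαη hE0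
      have e : P = α / 4 + η₀ / 2 + E * (α + 2 * η₀) := by rw [hP]; ring
      linarith
    have h8 : E * (C + 2) ≤ ε / 2 := by
      have e : E * (2 * (C + 2)) = 2 * (E * (C + 2)) := by ring
      linarith
    have h9 : π * N ≤ α / 4 * L ^ 2 + 3 * ε / 2 * L ^ 2 := by
      have a1 : P * L ^ 2 ≤ (α / 4 + η₀ / 2 + E * (C + 2)) * L ^ 2 :=
        mul_le_mul_of_nonneg_right h7 hL2
      have a2 : (η₀ / 2 + E * (C + 2)) * L ^ 2 ≤ ε * L ^ 2 :=
        mul_le_mul_of_nonneg_right (by linarith) hL2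
      have e : (α / 4 + η₀ / 2 + E * (C + 2)) * L ^ 2 =
          α / 4 * L ^ 2 + (η₀ / 2 + E * (C + 2)) * L ^ 2 := by ring
      linarith
    have h10 : π * (N - α * L ^ 2 / (4 * π)) ≤ π * (ε * L ^ 2) := by
      have e : π * (N - α * L ^ 2 / (4 * π)) = π * N - α / 4 * L ^ 2 := by
        field_simp
      rw [e]
      have a1 : 3 * ε / 2 * L ^ 2 ≤ π * (ε * L ^ 2) := by nlinarith
      linarith
    exact le_of_mul_le_mul_left h10 hπ
  -- LOWER
  have hlower : -(ε * L ^ 2) ≤ N - α * L ^ 2 / (4 * π) := by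
    rcases lt_or_ge α (2 * η₀) with hsmall | hbig
    · have h1 : α * L ^ 2 / (4 * π) ≤ ε * L ^ 2 := by
        rw [div_le_iff₀ (by positivity)]
        have a1 : α * L ^ 2 ≤ 2 * ε * L ^ 2 := mul_le_mul_of_nonneg_right (by linarith) hL2
        nlinarith
      linarith
    · have hη₀L : 0 ≤ η₀ * L := by positivity
      have hLo : ∀ u ∈ Icc (T + η₀ * L) (T + α * L - η₀ * L),
          (1 / 4 - E) * L ≤ (logDeriv (deBruijnH t) ((u : ℂ) - ((δ * L : ℝ) : ℂ) * I)).im := by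
        intro u hu
        have h1 : -η₀ ≤ (u - T) / L := by
          rw [le_div_iff₀ hL0]; linarith [hu.1]
        have h2 : (u - T) / L ≤ α + η₀ := by
          rw [div_le_iff₀ hL0]
          have e : (α + η₀) * L = α * L + η₀ * L := by ring
          linarith [hu.2]
        have h := (hpt ((u - T) / L) δ (hsK ((u - T) / L) h1 h2) hδI).1
        rwa [← hus u] at h
      have hsA : |η₀| ≤ K := hsK η₀ (by linarith only [hη₀0]) (by linarith only [hα0])
      have hsB : |α - η₀| ≤ K :=
        hsK (α - η₀) (by linarith only [hα0]) (by linarith only [hη₀0])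
      have hA' := (hpt η₀ η₀ hsA hη₀I).2
      have hB' := (hpt (α - η₀) η₀ hsB hη₀I).2
      have eB : T + (α - η₀) * L = T + α * L - η₀ * L := by ring
      rw [eB] at hB'
      have hlow := count_window_lower hΛ (E := E) (T := T) hL0 hδ0 hη₀0 hbig
        (by linarith only [hE0]) hLo hA' hB'
      have e4 : 4 * δ / η₀ = 2 * ρ := by rw [← hρδ]; ring
      rw [e4] at hlow
      -- `α·2ρ·(1/4+E) ≤ Cρ ≤ ε`
      have h7 : α * (2 * ρ) * (1 / 4 + E) ≤ ε := by
        have a1 : α * (2 * ρ) * (1 / 4 + E) ≤ α * (2 * ρ) * (1 / 2) :=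
          mul_le_mul_of_nonneg_left (by linarith only [hE4]) (by positivity)
        have a2 : α * ρ ≤ C * ρ := mul_le_mul_of_nonneg_right hαC hρ0.le
        have e : α * (2 * ρ) * (1 / 2) = α * ρ := by ring
        have e2 : (C + 1) * ρ = ρ * (C + 1) := by ring
        linarith only [a1, a2, e, e2, hρε', hρ0]
      -- `(1/4 − E)(α − 2η₀) ≥ α/4 − EC − η₀/2`
      have h9 : α / 4 - E * C - η₀ / 2 ≤ (1 / 4 - E) * (α - 2 * η₀) := by
        have a1 : E * α ≤ E * C := mul_le_mul_of_nonneg_left hαC hE0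
        have a2 : 0 ≤ E * η₀ := by positivity
        have e : (1 / 4 - E) * (α - 2 * η₀) = α / 4 - η₀ / 2 - E * α + 2 * (E * η₀) := by ring
        linarith only [a1, a2, e]
      have h10 : E * C ≤ ε / 2 := by
        have e : E * (2 * (C + 2)) = 2 * (E * C) + 4 * E := by ring
        linarith only [e, hEC, hE0]
      have h11 : α / 4 * L ^ 2 - 2 * ε * L ^ 2 ≤ π * N := by
        have a1 : (α / 4 - E * C - η₀ / 2) * L ^ 2 ≤ (1 / 4 - E) * (α - 2 * η₀) * L ^ 2 :=
          mul_le_mul_of_nonneg_right h9 hL2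
        have a2 : α * (2 * ρ) * (1 / 4 + E) * L ^ 2 ≤ ε * L ^ 2 :=
          mul_le_mul_of_nonneg_right h7 hL2
        have a3 : (E * C + η₀ / 2) * L ^ 2 ≤ ε * L ^ 2 :=
          mul_le_mul_of_nonneg_right (by linarith only [h10, hη₀ε]) hL2
        have e : (α / 4 - E * C - η₀ / 2) * L ^ 2 = α / 4 * L ^ 2 - (E * C + η₀ / 2) * L ^ 2 := by
          ring
        linarith only [hlow, a1, a2, a3, e]
      have h12 : π * (-(ε * L ^ 2)) ≤ π * (N - α * L ^ 2 / (4 * π)) := by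
        have e : π * (N - α * L ^ 2 / (4 * π)) = π * N - α / 4 * L ^ 2 := by
          field_simp
        rw [e]
        have a1 : 2 * ε * L ^ 2 ≤ π * (ε * L ^ 2) := by nlinarith only [hπ3, hεL]
        linarith only [h11, a1]
      exact le_of_mul_le_mul_left h12 hπ
  exact abs_le.2 ⟨hlower, hupper⟩

/-- **Theorem 3.2 (49) AS PRINTED, WITH CONTENT.** The as-printed named fact `thm32_littleO`
(range «`Λ < t ≤ 0`», `sInf`-free; threshold `T₀` before `t` and `α`) — so far in the tree only EX
FALSO (`thm32_littleO_holds`, from `Λ ≥ 0`) — proved along an effective version of the printed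
route: the set of real-rooted times is bounded below (Newman 1976,
`bddBelow_setOf_hasOnlyRealZeros_holds`), so every admissible `t` lies in one window `[L, 0]`, on
which `thm32_littleO_inner` gives a uniform threshold. No use of `Λ ≥ 0`.
[cite: RodgersTaoFMP2020, Theorem 3.2 (49) = Theorem 9 (49) p.23] -/
theorem thm32_littleO_content : thm32_littleO := by
  obtain ⟨L, hL⟩ := bddBelow_setOf_hasOnlyRealZeros_holds
  intro C hC ε hε
  obtain ⟨T₂, hT₂⟩ := thm32_littleO_inner (-L) C hC ε hε
  refine ⟨T₂, fun t hΛ ht0 α hα0 hαC T hT ↦ hT₂ t ⟨?_, ht0⟩ hΛ α hα0 hαC T hT⟩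
  obtain ⟨t₁, ht₁, hr⟩ := hΛ
  have := hL hr
  linarith

end RodgersTao2020

end Literature.NumberTheory.LFunctions
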